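import Summits.QuantumFields.BalabanUV.Beta.FP.BlockAveragedKernel
import Summits.QuantumFields.BalabanUV.Beta.FP.LatticeTaylorPath

/-!
# Road FP (binder row D1), row H′2-IR ∕ IR-1, GENERIC HALF — PART 2: THE DIPOLE GAIN FOR MEAN-ZERO WEIGHTS, THE DOUBLE AVERAGE,
# AND THE MARGINAL DEGREE `a = 4` (our bookkeeping; no object of Bałaban's enters)

HONEST DEPENDENCY (page 1, mandatory): continuum YM on T⁴ ⇐ BetaPertH ∧ nine spine estimates (0/9 proved); BetaPertH ⇐ (D1) ∧ (D4) ∧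
CAP+tail; G-an2-4 gates asym, D1 and NE2/3/4.  HONEST FRAMING (cell contract, verbatim): «discharging `BetaPertH` makes Bałaban's UV
stability UNCONDITIONAL — a real constructive-QFT result; it is NOT the continuum limit and NOT the Clay problem.»  THIS MODULE is
elementary real analysis on finite sums over `ℤ⁴` (our bookkeeping, not in print and not claimed to be): it cites nothing, mints no
`def … : Prop`, declares no data `def`, has 0 `sorry`.  It discharges NOTHING of row H′2-IR, of `hasym`, of D1 or of `BetaPertH`; it is
NOT (CONV-C), NOT D1, NOT the continuum limit, NOT Clay.

ABSOLUTE RULE (cell charter, verbatim): «No internally-minted statement may enter as a cited fact. Every hypothesis is either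
kernel-proved in this package or a verbatim quotation of a PUBLISHED theorem with page reference. The manuscript(s) under audit are NOT
citable for their own disputed steps — they are the thing under adjudication; programme-internal (2001/route/tribunal) claims are never
citable.»  Nothing is cited below; every analytic input is a displayed hypothesis.

SETTING (as in PART 1 `FP/BlockAveragedKernel`): a weight profile `w` read on `box 4 ρ` (mass `Σ|w| ≤ W₁`, flatness `|w| ≤ W∞`), a kernel
`K : ℤ⁴ → ℝ` with the value letter `|K z| ≤ A∕(‖z‖∞+1)^a` and — here — the first-difference letter `|K(z + e_i) − K z| ≤ A₁∕(‖z‖∞+1)^{a+1}`,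
the block sum `Σ_{s ∈ box 4 ρ} w s·K(p − s)` at relative position `p`.

CONTENT.
* §7 **DIPOLE** (`Σ_s w s = 0`): `blockSum_eq_sub_of_mean_zero`; far `abs_blockSum_le_dipole_far`: `2ρ < ‖p‖∞ ⟹ |Σ_s w s·K(p − s)| ≤
  W₁·(4ρ·2^{a+1}·A₁∕(‖p‖∞+1)^{a+1})` — each `K(p − s) − K p` telescopes along the coordinate path from `p` to `p − s`, which stays in the box of
  radius `ρ` around `p` (`LatticeTaylorPath.abs_taylor0D_le`); the profile **`abs_blockSum_le_dipole_profile`** (`a ≤ 3`, every `p`):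
  `|Σ_{s ∈ box ρ} w s·K(p − s)| ≤ 3^{a+1}·(ρ+1)·(6561·W∞(ρ+1)⁴·A + 4·W₁·A₁) ∕ (ρ + 1 + ‖p‖∞)^{a+1}` — one power of `(ρ+1)∕(ρ+1+‖p‖∞)` gained over
  PART 1 §5: the shape a MEAN-ZERO coarse row (a row of a constant-killing coarse operator) sees.
* §8 **DOUBLE AVERAGE** `abs_doubleBlockSum_le_profile` (iterate PART 1 §5; re-index the outer sum by `s ↦ −s`):
  `|Σ_{s∈box ρ}Σ_{s′∈box ρ′} w s·w′ s′·K(c + s − (c′ + s′))| ≤ 3^a(6561W∞(ρ+1)⁴ + W₁)·(3^a(6561W′∞(ρ′+1)⁴ + W′₁)·A) ∕ (ρ + 1 + ‖c − c′‖∞)^a`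
  — the `Q_n P Q_nᵀ` shape.
* §9 **THE MARGINAL DEGREE `a = 4 = d`**: `sum_box_inv_pow_four_le` (`Σ_{z∈box M}(‖z‖∞+1)^{−4} ≤ 97 + 64·log M`, `TransferUV.abs_sum_le_of_quartic`),
  `abs_blockSum_le_near_marginal` (`‖p‖∞ ≤ 2ρ ⟹ ≤ W∞·A·(97 + 64·log(3ρ))`) and **`abs_blockSum_le_profile_marginal`** (every `p`):
  `|Σ_s w s·K(p − s)| ≤ 81·(W∞·(ρ+1)⁴·(97 + 64·log(3ρ)) + W₁)·A ∕ (ρ + 1 + ‖p‖∞)⁴` — the near field is logarithmic in the block scale, as it must be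
  (e.g. second differences of a degree-2 leg through a block average; the loss is a `log n`, inside R-FP-19's MEAN grading).
NOT HERE: any `P^{BF}`, `Q_n`, `G_C`, Woodbury remainder or n-uniformity statement of row H′2-IR (owner), anything printed.
Unit `b2b-balaban-gan24-formalise-leaf-04` (gen 39, idle G-an2-4 swarm leaf seat, cross-lane), 2026-08-20; `LEAVES-FP.md` sub-row IR-1-GEN; journal INTENT l.20663.
-/

noncomputable section

namespace Summit.QuantumFields.BalabanUV.Beta.FP.BlockAveragedKernelDipole

open Finset
open scoped BigOperators
open Literature.Probability.LatticeModels (box mem_box box_mono zero_mem_box annulus mem_annulus)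
open Literature.MathematicalPhysics.QuantumFieldTheory.Balaban1983to89.Beta.DyadicShell
  (Pt supNorm natAbs_le_supNorm supNorm_le_iff natAbs_le_iff_mem mem_box_iff not_mem_box_iff mem_annulus_iff supNorm_eq_of_mem_sphere
   supNorm_eq_zero_iff supNorm_pos)
open Literature.MathematicalPhysics.QuantumFieldTheory.Balaban1983to89.Beta.TransferUV
  (card_annulus_succ_four_le sum_annulus_zero_eq_sum_shells abs_sum_le_of_quartic)
open Literature.MathematicalPhysics.QuantumFieldTheory.Balaban1983to89.Beta.GradedBubbles (supNorm_neg)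
open Summit.QuantumFields.BalabanUV.Beta.FP.LatticeTaylorPath (abs_taylor0D_le)
open Summit.QuantumFields.BalabanUV.Beta.FP.BlockAveragedKernel

/-! ## §7 THE DIPOLE GAIN: a mean-zero weight sees the kernel's first differences in the far field -/

/-- [our bookkeeping] A mean-zero weight does not see the value of the kernel at the position: `Σ_s w s·K(p − s) = Σ_s w s·(K(p − s) − K p)`. -/
theorem blockSum_eq_sub_of_mean_zero {w : Pt → ℝ} {ρ : ℕ} (hmean : ∑ s ∈ box 4 ρ, w s = 0) (K : Pt → ℝ) (p : Pt) :
    ∑ s ∈ box 4 ρ, w s * K (p - s) = ∑ s ∈ box 4 ρ, w s * (K (p - s) - K p) := by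
  simp only [mul_sub, sum_sub_distrib, ← sum_mul, hmean, zero_mul, sub_zero]

/-- **DIPOLE, FAR FIELD.**  With `Σ_s w s = 0`, the first-difference letter `|K(z + e_i) − K z| ≤ A₁∕(‖z‖∞+1)^{a+1}` and `2ρ < ‖p‖∞`:
`|Σ_s w s·K(p − s)| ≤ W₁·(4ρ·(2^{a+1}·A₁∕(‖p‖∞+1)^{a+1}))` — each `K(p − s) − K(p)` telescopes along the coordinate path from `p` to `p − s`,
which stays in the box of radius `ρ` around `p`, i.e. at distance `≥ (‖p‖∞+1)∕2 − 1` (`LatticeTaylorPath.abs_taylor0D_le`). [our bookkeeping] -/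
theorem abs_blockSum_le_dipole_far {w K : Pt → ℝ} {ρ a : ℕ} {A₁ W₁ : ℝ}
    (hΔ : ∀ z (i : Fin 4), |K (z + Pi.single i 1) - K z| ≤ A₁ / ((supNorm z : ℝ) + 1) ^ (a + 1))
    (hW1 : ∑ s ∈ box 4 ρ, |w s| ≤ W₁) (hmean : ∑ s ∈ box 4 ρ, w s = 0)
    {p : Pt} (hp : 2 * ρ < supNorm p) :
    |∑ s ∈ box 4 ρ, w s * K (p - s)| ≤ W₁ * (4 * (ρ : ℝ) * (2 ^ (a + 1) * A₁ / ((supNorm p : ℝ) + 1) ^ (a + 1))) := by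
  have hA1 : 0 ≤ A₁ := by
    have h := hΔ 0 0
    have h00 : supNorm (0 : Pt) = 0 := supNorm_eq_zero_iff.mpr rfl
    simp only [h00, Nat.cast_zero, zero_add, one_pow, div_one] at h
    exact (abs_nonneg _).trans h
  set B : ℝ := 2 ^ (a + 1) * A₁ / ((supNorm p : ℝ) + 1) ^ (a + 1) with hBdef
  have hB : 0 ≤ B := by positivity
  -- the zeroth-order Taylor bound along the coordinate path, inside the box of radius ρ around p
  have htay : ∀ s ∈ box 4 ρ, |K (p - s) - K p| ≤ (4 : ℝ) * ρ * B := by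
    intro s hs
    have hs' : ∀ i, |(-s) i| ≤ (ρ : ℤ) := fun i => by
      simpa using abs_apply_le_of_mem_box hs i
    have h := abs_taylor0D_le K p (-s) hs' hB (fun x hx i => ?_)
    · simpa [sub_eq_add_neg] using h
    · -- `x` is within `ρ` of `p` coordinatewise, hence `‖x − p‖∞ ≤ ρ` and `x = p − (p − x)` is in the far field of `p`
      have hxp : supNorm (p - x) ≤ ρ := by
        refine supNorm_le_iff.mpr fun j => ?_
        have h := abs_le.mp (hx j)
        rw [show (p - x) j = -(x j - p j) by rw [Pi.sub_apply, neg_sub], Int.natAbs_neg]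
        exact natAbs_le_iff_mem.mpr ⟨h.1, h.2⟩
      have hfar := letter_shift_far (a := a + 1) hA1 hxp hp
      rw [show p - (p - x) = x by abel] at hfar
      show |K (x + Pi.single i 1) - K x| ≤ B
      exact (hΔ x i).trans hfar
  rw [blockSum_eq_sub_of_mean_zero hmean]
  have hterm : ∀ s ∈ box 4 ρ, |w s * (K (p - s) - K p)| ≤ |w s| * (4 * (ρ : ℝ) * B) := by
    intro s hs
    rw [abs_mul]
    exact mul_le_mul_of_nonneg_left (htay s hs) (abs_nonneg _)
  calc |∑ s ∈ box 4 ρ, w s * (K (p - s) - K p)| ≤ ∑ s ∈ box 4 ρ, |w s * (K (p - s) - K p)| := abs_sum_le_sum_abs _ _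
    _ ≤ ∑ s ∈ box 4 ρ, |w s| * (4 * (ρ : ℝ) * B) := sum_le_sum hterm
    _ = (∑ s ∈ box 4 ρ, |w s|) * (4 * (ρ : ℝ) * B) := by rw [sum_mul]
    _ ≤ W₁ * (4 * (ρ : ℝ) * B) := mul_le_mul_of_nonneg_right hW1 (by positivity)

/-- **DIPOLE PROFILE.**  With `Σ_s w s = 0`, the value letter `A` (degree `a ≤ 3`) and the first-difference letter `A₁` (degree `a+1`), for
EVERY position `p`:
`|Σ_{s ∈ box ρ} w s·K(p − s)| ≤ 3^{a+1}·(ρ+1)·(6561·W∞·(ρ+1)⁴·A + 4·W₁·A₁) ∕ (ρ + 1 + ‖p‖∞)^{a+1}`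
— one power of `(ρ+1)∕(ρ+1+‖p‖∞)` gained over §5. [our bookkeeping] -/
theorem abs_blockSum_le_dipole_profile {w K : Pt → ℝ} {ρ a : ℕ} {A A₁ W₁ Winf : ℝ} (ha : a ≤ 3)
    (hK : ∀ z, |K z| ≤ A / ((supNorm z : ℝ) + 1) ^ a)
    (hΔ : ∀ z (i : Fin 4), |K (z + Pi.single i 1) - K z| ≤ A₁ / ((supNorm z : ℝ) + 1) ^ (a + 1))
    (hW1 : ∑ s ∈ box 4 ρ, |w s| ≤ W₁) (hWinf : ∀ s ∈ box 4 ρ, |w s| ≤ Winf) (hmean : ∑ s ∈ box 4 ρ, w s = 0) (p : Pt) :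
    |∑ s ∈ box 4 ρ, w s * K (p - s)|
      ≤ 3 ^ (a + 1) * ((ρ : ℝ) + 1) * (6561 * Winf * ((ρ : ℝ) + 1) ^ 4 * A + 4 * W₁ * A₁)
          / ((ρ : ℝ) + 1 + supNorm p) ^ (a + 1) := by
  have hA := letter_nonneg_of_le hK
  have hWi := flat_nonneg_of_le hWinf
  have hW := mass_nonneg_of_le hW1
  have hA1 : 0 ≤ A₁ := by
    have h := hΔ 0 0
    have h00 : supNorm (0 : Pt) = 0 := supNorm_eq_zero_iff.mpr rfl
    simp only [h00, Nat.cast_zero, zero_add, one_pow, div_one] at h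
    exact (abs_nonneg _).trans h
  have hD : (0 : ℝ) < ((ρ : ℝ) + 1 + supNorm p) ^ (a + 1) := by positivity
  rcases le_or_gt (supNorm p) (2 * ρ) with hp | hp
  · -- near field: the plain near bound, re-based to degree `a + 1`
    refine (abs_blockSum_le_near ha hK hWinf hp).trans ?_
    rw [le_div_iff₀ hD]
    have hna := near_arith (a := a + 1) (by omega) hp
    have e4 : 4 - a = (4 - (a + 1)) + 1 := by omega
    have hρ3 : ((3 * ρ : ℕ) + 1 : ℝ) ≤ 3 * ((ρ : ℝ) + 1) := by push_cast; linarith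
    have h39 : (81 : ℝ) * 243 ≤ 3 ^ (a + 1) * 6561 := by
      have : (3 : ℝ) ≤ 3 ^ (a + 1) := by
        calc (3 : ℝ) = 3 ^ 1 := by norm_num
          _ ≤ 3 ^ (a + 1) := pow_le_pow_right₀ (by norm_num) (by omega)
      nlinarith
    calc Winf * A * (81 * ((3 * ρ : ℕ) + 1 : ℝ) ^ (4 - a)) * ((ρ : ℝ) + 1 + supNorm p) ^ (a + 1)
        = Winf * A * 81 * ((3 * ρ : ℕ) + 1 : ℝ) *
            ((((3 * ρ : ℕ) + 1 : ℝ)) ^ (4 - (a + 1)) * ((ρ : ℝ) + 1 + supNorm p) ^ (a + 1)) := by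
          rw [e4, pow_succ]; ring
      _ ≤ Winf * A * 81 * (3 * ((ρ : ℝ) + 1)) * (81 * ((ρ : ℝ) + 1) ^ 4) := by
          gcongr
      _ = (81 * 243) * ((ρ : ℝ) + 1) * (Winf * ((ρ : ℝ) + 1) ^ 4 * A) := by ring
      _ ≤ (3 ^ (a + 1) * 6561) * ((ρ : ℝ) + 1) * (Winf * ((ρ : ℝ) + 1) ^ 4 * A) := by gcongr
      _ = 3 ^ (a + 1) * ((ρ : ℝ) + 1) * (6561 * Winf * ((ρ : ℝ) + 1) ^ 4 * A) := by ring
      _ ≤ 3 ^ (a + 1) * ((ρ : ℝ) + 1) * (6561 * Winf * ((ρ : ℝ) + 1) ^ 4 * A + 4 * W₁ * A₁) := by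
          gcongr
          · have : 0 ≤ 4 * W₁ * A₁ := by positivity
            linarith
  · -- far field: the dipole far bound, re-based
    refine (abs_blockSum_le_dipole_far hΔ hW1 hmean hp).trans ?_
    have hfa := far_arith (a + 1) hp
    have hρ : (ρ : ℝ) ≤ (ρ : ℝ) + 1 := by linarith
    calc W₁ * (4 * (ρ : ℝ) * (2 ^ (a + 1) * A₁ / ((supNorm p : ℝ) + 1) ^ (a + 1)))
        = 4 * W₁ * A₁ * (ρ : ℝ) * (2 ^ (a + 1) / ((supNorm p : ℝ) + 1) ^ (a + 1)) := by ring
      _ ≤ 4 * W₁ * A₁ * ((ρ : ℝ) + 1) * (3 ^ (a + 1) / ((ρ : ℝ) + 1 + supNorm p) ^ (a + 1)) := by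
          gcongr
      _ = 3 ^ (a + 1) * ((ρ : ℝ) + 1) * (4 * W₁ * A₁) / ((ρ : ℝ) + 1 + supNorm p) ^ (a + 1) := by ring
      _ ≤ 3 ^ (a + 1) * ((ρ : ℝ) + 1) * (6561 * Winf * ((ρ : ℝ) + 1) ^ 4 * A + 4 * W₁ * A₁)
            / ((ρ : ℝ) + 1 + supNorm p) ^ (a + 1) := by
          gcongr
          · have : 0 ≤ 6561 * Winf * ((ρ : ℝ) + 1) ^ 4 * A := by positivity
            linarith

/-! ## §8 THE DOUBLE AVERAGE: iterate the profile -/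

/-- [our bookkeeping] The profile at scale `ρ′` is itself a kernel letter of degree `a` (drop the `ρ′ + 1` shift in the denominator). -/
theorem letter_of_profile {G : Pt → ℝ} {C : ℝ} {ρ' a : ℕ} (hC : 0 ≤ C)
    (hG : ∀ q, |G q| ≤ C / ((ρ' : ℝ) + 1 + supNorm q) ^ a) (q : Pt) : |G q| ≤ C / ((supNorm q : ℝ) + 1) ^ a := by
  refine (hG q).trans (div_le_div_of_nonneg_left hC (by positivity) (pow_le_pow_left₀ (by positivity) (by linarith [(Nat.cast_nonneg ρ' : (0:ℝ) ≤ ρ')]) a))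

/-- **THE DOUBLE AVERAGE.**  Two weights `w` (scale `ρ`, letters `W₁`, `W∞`) and `w′` (scale `ρ′`, letters `W′₁`, `W′∞`) at centres `c`, `c′`
against a kernel of degree `a ≤ 3`:
`|Σ_{s ∈ box ρ} Σ_{s′ ∈ box ρ′} w s·w′ s′·K(c + s − (c′ + s′))| ≤ 3^a(6561W∞(ρ+1)⁴ + W₁)·(3^a(6561W′∞(ρ′+1)⁴ + W′₁)·A) ∕ (ρ + 1 + ‖c − c′‖∞)^a`
— §5 for the inner sum (a degree-`a` kernel in `c − c′ + s`), then §5 again for the outer sum re-indexed by `s ↦ −s`. [our bookkeeping] -/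
theorem abs_doubleBlockSum_le_profile {w w' K : Pt → ℝ} {ρ ρ' a : ℕ} {A W₁ Winf W₁' Winf' : ℝ} (ha : a ≤ 3)
    (hK : ∀ z, |K z| ≤ A / ((supNorm z : ℝ) + 1) ^ a)
    (hW1 : ∑ s ∈ box 4 ρ, |w s| ≤ W₁) (hWinf : ∀ s ∈ box 4 ρ, |w s| ≤ Winf)
    (hW1' : ∑ s ∈ box 4 ρ', |w' s| ≤ W₁') (hWinf' : ∀ s ∈ box 4 ρ', |w' s| ≤ Winf') (c c' : Pt) :
    |∑ s ∈ box 4 ρ, ∑ s' ∈ box 4 ρ', w s * w' s' * K (c + s - (c' + s'))|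
      ≤ 3 ^ a * (6561 * Winf * ((ρ : ℝ) + 1) ^ 4 + W₁) * (3 ^ a * (6561 * Winf' * ((ρ' : ℝ) + 1) ^ 4 + W₁') * A)
          / ((ρ : ℝ) + 1 + supNorm (c - c')) ^ a := by
  have hA := letter_nonneg_of_le hK
  have hWi' := flat_nonneg_of_le hWinf'
  have hW' := mass_nonneg_of_le hW1'
  -- the inner block sum as a kernel `G` of the relative position
  set G : Pt → ℝ := fun q => ∑ s' ∈ box 4 ρ', w' s' * K (q - s') with hGdef
  have hC' : 0 ≤ 3 ^ a * (6561 * Winf' * ((ρ' : ℝ) + 1) ^ 4 + W₁') * A := by positivity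
  have hG : ∀ q, |G q| ≤ 3 ^ a * (6561 * Winf' * ((ρ' : ℝ) + 1) ^ 4 + W₁') * A / ((supNorm q : ℝ) + 1) ^ a :=
    letter_of_profile hC' (fun q => abs_blockSum_le_profile ha hK hW1' hWinf' q)
  -- rewrite the double sum as an outer block sum of `G` in the `+s` convention, then flip `s ↦ −s`
  have hrew : ∑ s ∈ box 4 ρ, ∑ s' ∈ box 4 ρ', w s * w' s' * K (c + s - (c' + s'))
      = ∑ s ∈ box 4 ρ, (fun t => w (-t)) (-s) * G (c - c' - (-s)) := by
    refine sum_congr rfl fun s _ => ?_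
    rw [hGdef]
    simp only [neg_neg, mul_sum]
    refine sum_congr rfl fun s' _ => ?_
    rw [show c - c' - -s - s' = c + s - (c' + s') by abel]; ring
  rw [hrew, sum_box_comp_neg (fun t => (fun t => w (-t)) t * G (c - c' - t)) ρ]
  -- letters of the flipped weight
  have hW1n : ∑ s ∈ box 4 ρ, |(fun t => w (-t)) s| ≤ W₁ := by
    rw [sum_box_comp_neg (fun t => |w t|) ρ]; exact hW1
  have hWinfn : ∀ s ∈ box 4 ρ, |(fun t => w (-t)) s| ≤ Winf := fun s hs => hWinf (-s) (neg_mem_box_iff.mpr hs)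
  have h := abs_blockSum_le_profile (w := fun t => w (-t)) (K := G) ha hG hW1n hWinfn (c - c')
  simpa [mul_assoc, mul_div_assoc] using h

/-! ## §9 THE MARGINAL DEGREE `a = 4 = d`: the near field is logarithmic in the block scale -/

/-- **MARGINAL SHELL SUM.**  `Σ_{z ∈ box 4 M} (‖z‖∞+1)^{−4} ≤ 97 + 64·log M` (`TransferUV.abs_sum_le_of_quartic` on the punctured box, plus the
centre; `log 0 = 0`). [our bookkeeping] -/
theorem sum_box_inv_pow_four_le (M : ℕ) :
    ∑ z ∈ box 4 M, 1 / ((supNorm z : ℝ) + 1) ^ 4 ≤ 97 + 64 * Real.log M := by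
  rw [sum_box_eq_add_sum_annulus]
  have h0 : supNorm (0 : Pt) = 0 := supNorm_eq_zero_iff.mpr rfl
  rw [h0, Nat.cast_zero, zero_add, one_pow, div_one]
  have hf : ∀ r, ∀ z ∈ annulus 4 r (r + 1), |1 / ((supNorm z : ℝ) + 1) ^ 4| ≤ 1 / ((r : ℝ) + 1) ^ 4 := by
    intro r z hz
    rw [abs_of_nonneg (by positivity), supNorm_eq_of_mem_sphere hz]
    push_cast
    exact one_div_le_one_div_of_le (by positivity) (pow_le_pow_left₀ (by positivity) (by linarith) 4)
  have h := abs_sum_le_of_quartic (M := M) zero_le_one hf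
  have h' := (le_abs_self _).trans h
  linarith

/-- **NEAR FIELD, MARGINAL DEGREE.**  `‖p‖∞ ≤ 2ρ ⟹ |Σ_{s ∈ box ρ} w s·K(p − s)| ≤ W∞·A·(97 + 64·log(3ρ))` for `|K z| ≤ A∕(‖z‖∞+1)⁴`. [our bookkeeping] -/
theorem abs_blockSum_le_near_marginal {w K : Pt → ℝ} {ρ : ℕ} {A Winf : ℝ}
    (hK : ∀ z, |K z| ≤ A / ((supNorm z : ℝ) + 1) ^ 4) (hWinf : ∀ s ∈ box 4 ρ, |w s| ≤ Winf)
    {p : Pt} (hp : supNorm p ≤ 2 * ρ) :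
    |∑ s ∈ box 4 ρ, w s * K (p - s)| ≤ Winf * A * (97 + 64 * Real.log ((3 * ρ : ℕ) : ℝ)) :=
  (abs_blockSum_le_near_sum hK hWinf hp).trans
    (mul_le_mul_of_nonneg_left (sum_box_inv_pow_four_le (3 * ρ)) (mul_nonneg (flat_nonneg_of_le hWinf) (letter_nonneg_of_le hK)))

/-- **THE PROFILE, MARGINAL DEGREE.**  For `|K z| ≤ A∕(‖z‖∞+1)⁴` and EVERY position `p`:
`|Σ_{s ∈ box ρ} w s·K(p − s)| ≤ 81·(W∞·(ρ+1)⁴·(97 + 64·log(3ρ)) + W₁)·A ∕ (ρ + 1 + ‖p‖∞)⁴` — the far field is the kernel's own `r^{−4}`,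
the near field pays ONE logarithm of the block scale. [our bookkeeping] -/
theorem abs_blockSum_le_profile_marginal {w K : Pt → ℝ} {ρ : ℕ} {A W₁ Winf : ℝ}
    (hK : ∀ z, |K z| ≤ A / ((supNorm z : ℝ) + 1) ^ 4)
    (hW1 : ∑ s ∈ box 4 ρ, |w s| ≤ W₁) (hWinf : ∀ s ∈ box 4 ρ, |w s| ≤ Winf) (p : Pt) :
    |∑ s ∈ box 4 ρ, w s * K (p - s)|
      ≤ 81 * (Winf * ((ρ : ℝ) + 1) ^ 4 * (97 + 64 * Real.log ((3 * ρ : ℕ) : ℝ)) + W₁) * A / ((ρ : ℝ) + 1 + supNorm p) ^ 4 := by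
  have hA := letter_nonneg_of_le hK
  have hWi := flat_nonneg_of_le hWinf
  have hW := mass_nonneg_of_le hW1
  have hlog : 0 ≤ 97 + 64 * Real.log ((3 * ρ : ℕ) : ℝ) := by
    have := Real.log_natCast_nonneg (3 * ρ); linarith
  have hD : (0 : ℝ) < ((ρ : ℝ) + 1 + supNorm p) ^ 4 := by positivity
  rcases le_or_gt (supNorm p) (2 * ρ) with hp | hp
  · -- near field
    refine (abs_blockSum_le_near_marginal hK hWinf hp).trans ?_
    rw [le_div_iff₀ hD]
    have hp' : (supNorm p : ℝ) ≤ 2 * ρ := by exact_mod_cast hp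
    have h3 : ((ρ : ℝ) + 1 + supNorm p) ^ 4 ≤ 81 * ((ρ : ℝ) + 1) ^ 4 := by
      calc ((ρ : ℝ) + 1 + supNorm p) ^ 4 ≤ (3 * ((ρ : ℝ) + 1)) ^ 4 := pow_le_pow_left₀ (by positivity) (by linarith) 4
        _ = 81 * ((ρ : ℝ) + 1) ^ 4 := by ring
    calc Winf * A * (97 + 64 * Real.log ((3 * ρ : ℕ) : ℝ)) * ((ρ : ℝ) + 1 + supNorm p) ^ 4
        ≤ Winf * A * (97 + 64 * Real.log ((3 * ρ : ℕ) : ℝ)) * (81 * ((ρ : ℝ) + 1) ^ 4) :=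
          mul_le_mul_of_nonneg_left h3 (by positivity)
      _ = 81 * (Winf * ((ρ : ℝ) + 1) ^ 4 * (97 + 64 * Real.log ((3 * ρ : ℕ) : ℝ))) * A := by ring
      _ ≤ 81 * (Winf * ((ρ : ℝ) + 1) ^ 4 * (97 + 64 * Real.log ((3 * ρ : ℕ) : ℝ)) + W₁) * A := by
          gcongr; linarith
  · -- far field (PART 1 §4 holds in every degree)
    refine (abs_blockSum_le_far hK hW1 hp).trans ?_
    have hfa := far_arith 4 hp
    calc W₁ * (2 ^ 4 * A / ((supNorm p : ℝ) + 1) ^ 4) = W₁ * A * (2 ^ 4 / ((supNorm p : ℝ) + 1) ^ 4) := by ring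
      _ ≤ W₁ * A * (3 ^ 4 / ((ρ : ℝ) + 1 + supNorm p) ^ 4) := mul_le_mul_of_nonneg_left hfa (mul_nonneg hW hA)
      _ = 81 * W₁ * A / ((ρ : ℝ) + 1 + supNorm p) ^ 4 := by ring
      _ ≤ 81 * (Winf * ((ρ : ℝ) + 1) ^ 4 * (97 + 64 * Real.log ((3 * ρ : ℕ) : ℝ)) + W₁) * A
            / ((ρ : ℝ) + 1 + supNorm p) ^ 4 := by
          gcongr
          · have : 0 ≤ Winf * ((ρ : ℝ) + 1) ^ 4 * (97 + 64 * Real.log ((3 * ρ : ℕ) : ℝ)) := by positivity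
            linarith

end Summit.QuantumFields.BalabanUV.Beta.FP.BlockAveragedKernelDipole

end
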